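import Summits.Ventures.Crystal3D.Theorems.StickyWulffConstantGenericWallFloorStarFarHolds
import Summits.Ventures.Crystal3D.Theorems.StickyWulffConstantGenericWallFloorRegisteredResidualWide
import Summits.Ventures.Crystal3D.Theorems.StickyWulffConstantGenericWallFloorOfP5Exhaustion
import HarnessLib

/-!
# Lane G after the kernel discharge of `StarPairFar`: the crux `GenericWallFloor` modulo `P5Exhaustion` and the residual only

HONEST FRAMING. Venture `Summits/Ventures/Crystal3D` (cell `crystal3d-full`), helper `--supports` the crux
`GenericWallFloor` (stmt-Ventures-19480) of `route-Ventures-StickyWulffConstant`, line `WallLedgerG`.  Rung credit only;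
F-C1 not moved.  BOOK-KEEPING: with `StarFar.starPairFar_holds` (computational grade) the hypothesis `hfar : StarPairFar` of
the lane-G heads is discharged.  The debt of lane G at `c₀ = 1` is now {`P5Exhaustion` (E1; certified computation cf-p2 R38 /
lit lineage B, NOT in the kernel), the typed residual} — stated here for the three heads of record:
`genericWallFloor_of_p5_core` (residual `GenericWallFloorCore`), `genericWallFloor_of_p5_coreResidualTilt`
(`GenericWallFloorCoreResidualTilt`, 19480-p1 g7), `genericWallFloor_of_p5_registeredResidualWide`
(`GenericWallFloorRegisteredResidualWide`, the residual of record, cf-p1 ROUTE §86(20)).  Also the `ExactOnly`-keyed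
forms without `hfar`.
WHAT THIS IS NOT: `P5Exhaustion` is untouched; no residual is proved; F-C1 not moved.
-/

noncomputable section

namespace Summit.Ventures.Crystal3D.Theorems

open Finset
open scoped RealInnerProductSpace

/-- Lane G from `ExactOnly`(C12-55) and the core residual — `StarPairFar` discharged. -/
theorem genericWallFloor_of_exactOnly_core {s₀ : EuclideanSpace ℝ (Fin 3)} (hs₀ : s₀ ∈ fccSlots)
    (hcert : ExactOnly 0 (fccSlots.filter fun w => 0 < ⟪w, s₀⟫)) (hcore : GenericWallFloorCore) :
    Summit.Ventures.Crystal3D.Theses.StickyWulffConstant.GenericWallFloor :=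
  genericWallFloor_of_core hs₀ hcert StarFar.starPairFar_holds hcore

/-- **`GenericWallFloor` from `P5Exhaustion` and the core residual** (was `genericWallFloor_of_core_p5` with `hfar`). -/
theorem genericWallFloor_of_p5_core (hE1 : P5Exhaustion) (hcore : GenericWallFloorCore) :
    Summit.Ventures.Crystal3D.Theses.StickyWulffConstant.GenericWallFloor :=
  genericWallFloor_of_core_p5 hE1 StarFar.starPairFar_holds hcore

/-- **`GenericWallFloor` from `P5Exhaustion` and the re-shrunk residual `GenericWallFloorCoreResidualTilt`.** -/
theorem genericWallFloor_of_p5_coreResidualTilt (hE1 : P5Exhaustion) (hres : GenericWallFloorCoreResidualTilt) :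
    Summit.Ventures.Crystal3D.Theses.StickyWulffConstant.GenericWallFloor := by
  obtain ⟨s₀, hs₀, hcert⟩ := exactOnly_star_of_p5Exhaustion hE1
  exact genericWallFloor_of_coreResidualTilt hs₀ hcert StarFar.starPairFar_holds hres

/-- **`GenericWallFloor` from `P5Exhaustion` and the residual of record `GenericWallFloorRegisteredResidualWide`.** -/
theorem genericWallFloor_of_p5_registeredResidualWide (hE1 : P5Exhaustion)
    (hres : GenericWallFloorRegisteredResidualWide) :
    Summit.Ventures.Crystal3D.Theses.StickyWulffConstant.GenericWallFloor := by
  obtain ⟨s₀, hs₀, hcert⟩ := exactOnly_star_of_p5Exhaustion hE1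
  exact genericWallFloor_of_registeredResidualWide hs₀ hcert StarFar.starPairFar_holds hres

/-- The same keyed to `ExactOnly`(C12-55) (for seats working modulo E1 by name). -/
theorem genericWallFloor_of_exactOnly_registeredResidualWide {s₀ : EuclideanSpace ℝ (Fin 3)} (hs₀ : s₀ ∈ fccSlots)
    (hcert : ExactOnly 0 (fccSlots.filter fun w => 0 < ⟪w, s₀⟫)) (hres : GenericWallFloorRegisteredResidualWide) :
    Summit.Ventures.Crystal3D.Theses.StickyWulffConstant.GenericWallFloor :=
  genericWallFloor_of_registeredResidualWide hs₀ hcert StarFar.starPairFar_holds hres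

end Summit.Ventures.Crystal3D.Theorems

end
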